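import Summits.BirchSwinnertonDyer.Rank1Residual.Iwasawa.NonsplitTowerPrimeToP
import Summits.BirchSwinnertonDyer.Rank1Residual.Iwasawa.InertiaCohomologyPTorsionFinite
import Summits.BirchSwinnertonDyer.BirchSwinnertonDyer.Theorems.UniversalToricDescentResidualSelmerFinite
import HarnessLib

/-!
# Route UniversalToricDescent — the `Σ`-passage for Castella's anticyclotomic Selmer groups:
# `Sel_𝔭^Σ(K_∞, E[p^∞])[p]` finite ⟹ `Sel_𝔭^{Σ ∪ Σ′}(K_∞, E[p^∞])[p]` finite for `Σ′` finite,
# prime to `p` and FINITELY DECOMPOSED in `K_∞` (Greenberg–Vatsal Prop. (2.4), finiteness form)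

Lead prover bsd-wall-utd-p1 g6 (`--supports stmt-BirchSwinnertonDyer-20399`; PRICING-20399-ALG-HALF §3(a) last
step / §8 (5)). The port-grade child B′1 `TorsionMuTransportModThree` of crux 20399 is stated at `Σ = ∅` on both
curves, while the residual comparison (`UniversalToricDescentResidualSelmerTransfer`) runs at a common
`Σ ⊇ {bad places prime to p}`; the twin-side passage `∅ → Σ` is the content of this file. For ANY number
field `K`, ANY `ℤ_p`-extension `κ` (`H = Gal(K̄/K_∞)`), any distinguished `𝔭` and a place `v ∤ p` whose
decomposition group is NOT contained in `H` (finitely decomposed; in the anticyclotomic tower: `v` over a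
rational prime split in `K`, Brink Thm. 2 = route leaf 20465):

* §1 `finite_subgroupH1_inf_decomp_geomTorsion` — **`H¹(H ⊓ D_v, E[p])` is finite**: the tree's LOCAL
  theorem `Iwasawa.finite_subgroupH1_and_natCard_le` (`H¹(Gal(K̄_v/K_{∞,η}), B)` finite for finite
  `p`-primary `B` at a non-split `v ∤ p`: the tower is prime-to-`p` over inertia, Greenberg LNM 1716 §3 /
  Greenberg–Vatsal §2) for `B = E[p]` with its `Γ_{K_v}`-action through the chosen embedding, moved to
  the GLOBAL group `H ⊓ D_v = res(Gal(K̄_v/K_{∞,η}))` by inflation along the surjection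
  (`Iwasawa.resH1Hom_injective_of_surjective`);
  `finite_pTorsion_subgroupH1_inf_decomp` — hence `H¹(H ⊓ D_v, E[p^∞])[p]` is finite (Kummer surjection
  `exists_torsionToPrimaryH1Sub_eq`).
* §2 **`finite_selmerAc_pTorsion_insert`** — `Sel_𝔭^Σ(K_∞, E[p^∞])[p]` finite ⟹ `Sel_𝔭^{Σ ∪ {v}}[p]` finite:
  the away conditions at `v` for ALL conjugates follow from `p^c` representatives
  (`UniversalToricDescentResidualSelmerFinite.forall_resOfLe_conjH1_eq_zero_of_reps`), so
  `s ↦ (res_{H⊓D_v} conj_{τ i} s)_i` has kernel in `Sel_𝔭^Σ[p]` and values in the finite `∏ H¹(H⊓D_v)[p]`;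
  `finite_selmerAc_pTorsion_union` — the same for a finite set of such places.

THEOREMS ONLY; no definition, no named fact, no `sorry`. BSD is not advanced by this file.
References: [GreenbergVatsal2000] §2 Prop. (2.4), Cor. (2.3); [GreenbergLNM1716] §3 Lemma 3.3 (p. 87),
Coates §3 Lemma 3.8; [Castella2018] Def. 2.2 ("`Σ`-imprimitive"); [Brink2007] Thm. 2.
-/

set_option autoImplicit false
-- `…BirchSwinnertonDyer.BirchSwinnertonDyer.Theorems…` is the problem's mandated namespace (D-0017).
set_option linter.dupNamespace false

noncomputable section

open scoped Classical

namespace Summit.BirchSwinnertonDyer.BirchSwinnertonDyer.Theorems.UniversalToricDescentSigmaPassage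

open NumberField IsDedekindDomain Field
open Literature.NumberTheory.EllipticCurves Literature.NumberTheory.EllipticCurves.GreenbergSelmer
  Literature.NumberTheory.GaloisRepresentations WeierstrassCurve
  Summit.BirchSwinnertonDyer.Rank1Residual.X11b Summit.BirchSwinnertonDyer.Rank1Residual.X11b.AcSelmer
  Summit.BirchSwinnertonDyer.Rank1Residual.Iwasawa
  Summit.BirchSwinnertonDyer.BirchSwinnertonDyer.Theorems.UniversalToricDescentResidualSelmerFinite

variable {K : Type} [Field K] [NumberField K] (W : WeierstrassCurve K) [W.IsElliptic] {p : ℕ}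
  [Fact p.Prime] (κ : ZpExtension K p)

/-! ### §1 `H¹(H ⊓ D_v, E[p])` and `H¹(H ⊓ D_v, E[p^∞])[p]` are finite at a finitely decomposed `v ∤ p` -/

/-- **`H¹(Gal(K̄/K_∞) ⊓ D_v, E[p])` is finite at a place `v ∤ p` finitely decomposed in `K_∞`**
(`D_v ⊄ ker κ`). The local group `Gal(K̄_v/K_{∞,η}) ≤ Γ_{K_v}` surjects onto `ker κ ⊓ D_v` under
restriction along the chosen embedding; on it `H¹(·, E[p])` is finite by the tree's prime-to-`p` tower
theorem (`Iwasawa.finite_subgroupH1_and_natCard_le`; `#E[p] = p²` is prime to the residue characteristic),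
and inflation along a surjection is injective. [cite: GreenbergLNM1716, §3 Lemma 3.3 (proof, p. 87)]
[cite: GreenbergVatsal2000, §2 Prop. (2.4)] -/
theorem finite_subgroupH1_inf_decomp_geomTorsion {v : HeightOneSpectrum (𝓞 K)}
    (hpv : (p : 𝓞 K) ∉ v.asIdeal) (hv : ¬ (decomp v ≤ κ.kerSubgroup)) :
    Finite (Literature.NumberTheory.EllipticCurves.subgroupH1 (κ.kerSubgroup ⊓ decomp v)
      (W.geomTorsion (p : ℤ))) := by
  have hp : p.Prime := Fact.out
  -- the local action through the chosen embedding (a local instance of this proof only)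
  letI : DistribMulAction (absoluteGaloisGroup (v.adicCompletion K)) (W.geomTorsion (p : ℤ)) :=
    DistribMulAction.compHom _ (absGaloisRestrict K (v.adicCompletion K)).toMonoidHom
  haveI : ContinuousSMul (absoluteGaloisGroup K) (W.geomTorsion (p : ℤ)) :=
    WeierstrassCurve.continuousSMul_geomTorsion W (WeierstrassCurve.isOpen_stabilizer_point_holds W) _
  have hcont : ∀ b : W.geomTorsion (p : ℤ),
      Continuous fun σ : absoluteGaloisGroup (v.adicCompletion K) ↦ σ • b := fun b ↦ by
    change Continuous fun σ : absoluteGaloisGroup (v.adicCompletion K) ↦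
      absGaloisRestrict K (v.adicCompletion K) σ • b
    exact (continuous_id.smul continuous_const :
      Continuous fun τ : absoluteGaloisGroup K ↦ τ • b).comp
        (absGaloisRestrict K (v.adicCompletion K)).continuous_toFun
  -- `v` not split completely: some `σ ∈ Γ_{K_v}` restricts outside `ker κ`
  have hns : ∃ σ : absoluteGaloisGroup (v.adicCompletion K),
      σ ∉ localSubgroup κ.kerSubgroup (v.adicCompletion K) := by
    by_contra hall
    refine hv fun g hg ↦ ?_
    obtain ⟨σ, rfl⟩ := (mem_decomp_iff v g).mp hg
    have hσ : σ ∈ localSubgroup κ.kerSubgroup (v.adicCompletion K) :=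
      not_not.mp fun h ↦ hall ⟨σ, h⟩
    have h := (mem_localSubgroup_iff κ.kerSubgroup (v.adicCompletion K) σ).mp hσ
    rwa [resGal_eq_absGaloisRestrict] at h
  -- `E[p]` is finite of order `p²`, prime to the residue characteristic; `p`-torsion
  haveI : Finite (W.geomTorsion (p : ℤ)) :=
    WeierstrassCurve.finite_torsionPoints_holds W (AlgebraicClosure K) (by exact_mod_cast hp.ne_zero)
  have hcard : Nat.card (W.geomTorsion (p : ℤ)) = p ^ 2 :=
    WeierstrassCurve.card_torsionPoints_eq_sq_holds W (AlgebraicClosure K) (by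
      haveI : CharZero (AlgebraicClosure K) :=
        charZero_of_injective_algebraMap (algebraMap K (AlgebraicClosure K)).injective
      exact_mod_cast hp.ne_zero)
  have hℓ := ringChar_residueField_prime (F := v.adicCompletion K)
  have hne := v.ringChar_residueField_adicCompletion_ne hpv
  have hB : ∃ k : ℕ, ∀ b : W.geomTorsion (p : ℤ), p ^ k • b = 0 := ⟨1, fun b ↦ by
    rw [pow_one]
    exact Subtype.ext (by
      rw [AddSubgroupClass.coe_nsmul, ZeroMemClass.coe_zero, ← natCast_zsmul]
      exact (mem_geomTorsion_iff W (p : ℤ) _).mp b.2)⟩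
  have hfin := (NonsplitTower.finite_subgroupH1_and_natCard_le κ hpv hns hB (by
    rw [hcard]
    exact ((Nat.coprime_primes hp hℓ).2 (Ne.symm hne)).pow_left 2) hcont).1
  -- inflation along `Gal(K̄_v/K_{∞,η}) ↠ ker κ ⊓ D_v`
  let θ : localSubgroup κ.kerSubgroup (v.adicCompletion K) →ₜ* (κ.kerSubgroup ⊓ decomp v :
      Subgroup (absoluteGaloisGroup K)) :=
    { toFun := fun x ↦ ⟨absGaloisRestrict K (v.adicCompletion K) x, Subgroup.mem_inf.mpr ⟨by
          have h := (mem_localSubgroup_iff κ.kerSubgroup (v.adicCompletion K) x.1).mp x.2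
          rwa [resGal_eq_absGaloisRestrict] at h, (mem_decomp_iff v _).mpr ⟨x, rfl⟩⟩⟩
      map_one' := Subtype.ext (by simp)
      map_mul' := fun x y ↦ Subtype.ext (by simp)
      continuous_toFun :=
        ((absGaloisRestrict K (v.adicCompletion K)).continuous_toFun.comp
          continuous_subtype_val).subtype_mk _ }
  have hθ : Function.Surjective θ := by
    rintro ⟨g, hg⟩
    obtain ⟨hgH, hgD⟩ := Subgroup.mem_inf.mp hg
    obtain ⟨σ, rfl⟩ := (mem_decomp_iff v g).mp hgD
    have hσ : σ ∈ localSubgroup κ.kerSubgroup (v.adicCompletion K) := by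
      rw [mem_localSubgroup_iff, resGal_eq_absGaloisRestrict]; exact hgH
    exact ⟨⟨σ, hσ⟩, rfl⟩
  exact Finite.of_injective _ (resH1Hom_injective_of_surjective θ hθ fun _ _ ↦ rfl)

/-- **`H¹(Gal(K̄/K_∞) ⊓ D_v, E[p^∞])[p]` is finite at a finitely decomposed `v ∤ p`**: every
`p`-torsion class is the image of a class of `H¹(·, E[p])` (`exists_torsionToPrimaryH1Sub_eq`), a finite
group by `finite_subgroupH1_inf_decomp_geomTorsion`. (The `p`-torsion of Greenberg–Vatsal's local factor
`𝓗_v(K_∞)` at the chosen place above `v`.) [cite: GreenbergVatsal2000, §2 Prop. (2.4)] -/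
theorem finite_pTorsion_subgroupH1_inf_decomp {v : HeightOneSpectrum (𝓞 K)}
    (hpv : (p : 𝓞 K) ∉ v.asIdeal) (hv : ¬ (decomp v ≤ κ.kerSubgroup)) :
    Set.Finite {c : W.subgroupH1 p (κ.kerSubgroup ⊓ decomp v) | p • c = 0} := by
  haveI := finite_subgroupH1_inf_decomp_geomTorsion W κ hpv hv
  refine (Set.finite_range (W.torsionToPrimaryH1Sub p (κ.kerSubgroup ⊓ decomp v))).subset
    fun c hc ↦ ?_
  obtain ⟨y, hy⟩ := W.exists_torsionToPrimaryH1Sub_eq p W.zsmul_geomPoints_surjective_holds hc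
  exact ⟨y, hy⟩

/-! ### §2 The `Σ`-passage -/

/-- **One place: `Sel_𝔭^Σ(K_∞, E[p^∞])[p]` finite ⟹ `Sel_𝔭^{Σ ∪ {v}}(K_∞, E[p^∞])[p]` finite** for a place
`v ∤ p` finitely decomposed in `K_∞` (`D_v ⊄ ker κ`). On the `p`-torsion of `Sel^{Σ ∪ {v}}` the signature
`s ↦ (res_{H⊓D_v} conj_{τ i} s)_{i<p^c}` (`τ i` representatives, `forall_resOfLe_conjH1_eq_zero_of_reps`)
takes values in the finite `∏ H¹(H ⊓ D_v, E[p^∞])[p]` (§1) and its kernel satisfies the away condition at `v`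
for every conjugate, i.e. lies in `Sel^Σ[p]`. [cite: GreenbergVatsal2000, §2 Cor. (2.3), Prop. (2.4)]
[cite: Castella2018, Def. 2.2 (arXiv:1704.06608 p. 5)] -/
theorem finite_selmerAc_pTorsion_insert {𝔭 : HeightOneSpectrum (𝓞 K)}
    {S : Set (HeightOneSpectrum (𝓞 K))} {v : HeightOneSpectrum (𝓞 K)}
    (hpv : (p : 𝓞 K) ∉ v.asIdeal) (hv : ¬ (decomp v ≤ κ.kerSubgroup))
    (hfin : Set.Finite {s : selmerAc W p κ 𝔭 S | p • s = 0}) :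
    Set.Finite {s : selmerAc W p κ 𝔭 (insert v S) | p • s = 0} := by
  have hpr : p.Prime := Fact.out
  set H := κ.kerSubgroup with hH
  let A : Type := ↥(W.geomPrimaryTorsion p)
  -- representatives at `v`
  obtain ⟨c, hc⟩ := forall_resOfLe_conjH1_eq_zero_of_reps (M := A) (κ := κ) v hv
  have hτex : ∀ i : ℕ, ∃ τ : absoluteGaloisGroup K, κ τ = Multiplicative.ofAdd ((i : ℕ) : ℤ_[p]) :=
    fun i ↦ κ.surjective _
  choose τ hτ using hτex
  -- the signature map
  let resv : W.subgroupH1 p H →+ W.subgroupH1 p (H ⊓ decomp v) :=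
    resOfLe A (inf_le_left : H ⊓ decomp v ≤ H)
  let Ψ : W.subgroupH1 p H →+ (Fin (p ^ c) → W.subgroupH1 p (H ⊓ decomp v)) :=
    { toFun := fun x i ↦ resv (W.conjH1 p H (τ i) x)
      map_zero' := by ext i; simp
      map_add' := fun x y ↦ by ext i; simp }
  -- the `p`-torsion of `Sel^{Σ ∪ {v}}` as a subgroup of `H¹(K_∞, E[p^∞])`
  let Y : AddSubgroup (W.subgroupH1 p H) :=
    { carrier := {x | x ∈ selmerAc W p κ 𝔭 (insert v S) ∧ p • x = 0}
      zero_mem' := ⟨AddSubgroup.zero_mem _, smul_zero _⟩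
      add_mem' := fun {a b} ha hb ↦ ⟨AddSubgroup.add_mem _ ha.1 hb.1, by
        rw [smul_add, ha.2, hb.2, add_zero]⟩
      neg_mem' := fun {a} ha ↦ ⟨AddSubgroup.neg_mem _ ha.1, by rw [smul_neg, ha.2, neg_zero]⟩ }
  have hYmem : ∀ x, x ∈ Y ↔ x ∈ selmerAc W p κ 𝔭 (insert v S) ∧ p • x = 0 := fun x ↦ Iff.rfl
  -- (a) on `Y`, `Ψ` takes values in the finite `p`-torsion of `H¹(H ⊓ D_v, E[p^∞])`
  let T : Set (Fin (p ^ c) → W.subgroupH1 p (H ⊓ decomp v)) :=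
    Set.pi Set.univ fun _ ↦ {c : W.subgroupH1 p (H ⊓ decomp v) | p • c = 0}
  have hTfin : T.Finite := Set.Finite.pi fun _ ↦ finite_pTorsion_subgroupH1_inf_decomp W κ hpv hv
  have hΨT : ∀ x ∈ Y, Ψ x ∈ T := by
    intro x hx
    simp only [T, Set.mem_univ_pi, Set.mem_setOf_eq]
    intro i
    change p • resv (W.conjH1 p H (τ i) x) = 0
    rw [← map_nsmul, ← map_nsmul, hx.2, map_zero, map_zero]
  -- (b) the kernel of `Ψ` on `Y` lies in (the image of) `Sel^Σ[p]`
  have hΨker : ∀ x ∈ Y, Ψ x = 0 → x ∈ selmerAc W p κ 𝔭 S := by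
    intro x hx hΨ
    have hxS := (mem_selmerOver_iff _).mp hx.1
    rw [selmerAc, mem_selmerOver_iff]
    refine ⟨fun w hpw hwS σ ↦ ?_, hxS.2.1, hxS.2.2⟩
    by_cases hwv : w = v
    · subst hwv
      rw [awayKer, AddMonoidHom.mem_ker]
      refine hc τ hτ x (fun i hi ↦ ?_) σ
      exact congrFun hΨ ⟨i, hi⟩
    · exact hxS.1 w hpw (fun h ↦ by
        rcases Set.mem_insert_iff.mp h with h | h
        · exact hwv h
        · exact hwS h) σ
  -- (c) `Y` is finite
  have hYfin : (Y : Set (W.subgroupH1 p H)).Finite := by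
    let g : Y →+ (Fin (p ^ c) → W.subgroupH1 p (H ⊓ decomp v)) := Ψ.comp Y.subtype
    have hgker : ((g.ker : AddSubgroup Y) : Set Y).Finite := by
      -- the kernel embeds into `Sel^Σ[p]`
      let j : {r : Y // r ∈ g.ker} → {s : selmerAc W p κ 𝔭 S | p • s = 0} := fun r ↦
        ⟨⟨(r.1 : W.subgroupH1 p H), hΨker r.1 r.1.2 ((AddMonoidHom.mem_ker).mp r.2)⟩, by
          change p • (⟨(r.1 : W.subgroupH1 p H), _⟩ : selmerAc W p κ 𝔭 S) = 0
          exact Subtype.ext (by rw [AddSubgroupClass.coe_nsmul]; exact r.1.2.2)⟩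
      have hj : Function.Injective j := by
        intro r r' h
        have h' := congrArg (fun s : {s : selmerAc W p κ 𝔭 S | p • s = 0} ↦
          ((s : selmerAc W p κ 𝔭 S) : W.subgroupH1 p H)) h
        exact Subtype.ext (Subtype.ext h')
      haveI := hfin.to_subtype
      exact Set.finite_coe_iff.mp (Finite.of_injective j hj)
    have huniv : (g ⁻¹' T) = Set.univ := by
      ext r
      simp only [Set.mem_preimage, Set.mem_univ, iff_true]
      exact hΨT r r.2
    have hYuniv : (Set.univ : Set Y).Finite := by
      rw [← huniv]
      exact AddMonoidHom.finite_preimage_of_finite_ker g hgker hTfin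
    have : (Y : Set (W.subgroupH1 p H)) = (fun r : Y ↦ (r : W.subgroupH1 p H)) '' Set.univ := by
      ext x
      simp only [SetLike.mem_coe, Set.image_univ, Set.mem_range, Subtype.exists, exists_prop,
        exists_eq_right]
    rw [this]
    exact hYuniv.image _
  -- (d) conclude
  refine (hYfin.preimage (Subtype.val_injective.injOn)).subset fun s hs ↦ ?_
  change (s : W.subgroupH1 p H) ∈ Y
  refine ⟨s.2, ?_⟩
  have := congrArg (fun z : selmerAc W p κ 𝔭 (insert v S) ↦ (z : W.subgroupH1 p H)) hs
  simpa only [AddSubgroupClass.coe_nsmul, ZeroMemClass.coe_zero] using this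

/-- **Finitely many places: `Sel_𝔭^Σ(K_∞, E[p^∞])[p]` finite ⟹ `Sel_𝔭^{Σ ∪ Σ′}(K_∞, E[p^∞])[p]` finite**
for `Σ′` a finite set of places `v ∤ p`, each finitely decomposed in `K_∞` (induction on `Σ′`).
[cite: GreenbergVatsal2000, §2 Cor. (2.3), Prop. (2.4)] -/
theorem finite_selmerAc_pTorsion_union {𝔭 : HeightOneSpectrum (𝓞 K)}
    {S S' : Set (HeightOneSpectrum (𝓞 K))} (hS' : S'.Finite)
    (hS'p : ∀ v ∈ S', (p : 𝓞 K) ∉ v.asIdeal) (hS'dec : ∀ v ∈ S', ¬ (decomp v ≤ κ.kerSubgroup))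
    (hfin : Set.Finite {s : selmerAc W p κ 𝔭 S | p • s = 0}) :
    Set.Finite {s : selmerAc W p κ 𝔭 (S ∪ S') | p • s = 0} := by
  induction S', hS' using Set.Finite.induction_on with
  | empty => rwa [Set.union_empty]
  | @insert v T hvT hT ih =>
    rw [Set.union_insert]
    exact finite_selmerAc_pTorsion_insert W κ (hS'p v (Set.mem_insert v T))
      (hS'dec v (Set.mem_insert v T))
      (ih (fun w hw ↦ hS'p w (Set.mem_insert_of_mem v hw))
        (fun w hw ↦ hS'dec w (Set.mem_insert_of_mem v hw)))

/-- **`Sel_𝔭^∅(K_∞, E[p^∞])[p]` finite ⟹ `Sel_𝔭^Σ(K_∞, E[p^∞])[p]` finite** for a finite `Σ` of places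
`v ∤ p` finitely decomposed in `K_∞` (the twin-side passage `∅ → Σ` of the route's B′1).
[cite: GreenbergVatsal2000, §2 Cor. (2.3), Prop. (2.4)] -/
theorem finite_selmerAc_pTorsion_of_empty {𝔭 : HeightOneSpectrum (𝓞 K)}
    {S : Set (HeightOneSpectrum (𝓞 K))} (hS : S.Finite)
    (hSp : ∀ v ∈ S, (p : 𝓞 K) ∉ v.asIdeal) (hSdec : ∀ v ∈ S, ¬ (decomp v ≤ κ.kerSubgroup))
    (hfin : Set.Finite {s : selmerAc W p κ 𝔭 ∅ | p • s = 0}) :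
    Set.Finite {s : selmerAc W p κ 𝔭 S | p • s = 0} := by
  have h := finite_selmerAc_pTorsion_union W κ (S := ∅) hS hSp hSdec hfin
  rwa [Set.empty_union] at h

omit [W.IsElliptic] in
/-- **`Sel_𝔭^Σ(K_∞, E[p^∞])[p]` finite ⟹ `Sel_𝔭^∅(K_∞, E[p^∞])[p]` finite** (any `Σ`; `Sel_𝔭^∅ ≤ Sel_𝔭^Σ`,
`selmerAc_empty_le`) — the `E`-side passage `Σ → ∅`. [cite: Castella2018, Def. 2.2 (arXiv:1704.06608 p. 5)] -/
theorem finite_selmerAc_pTorsion_empty_of {𝔭 : HeightOneSpectrum (𝓞 K)}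
    {S : Set (HeightOneSpectrum (𝓞 K))} (hfin : Set.Finite {s : selmerAc W p κ 𝔭 S | p • s = 0}) :
    Set.Finite {s : selmerAc W p κ 𝔭 ∅ | p • s = 0} := by
  have himg : (fun s : selmerAc W p κ 𝔭 ∅ ↦ (s : W.subgroupH1 p κ.kerSubgroup)) '' {s | p • s = 0} ⊆
      (fun s : selmerAc W p κ 𝔭 S ↦ (s : W.subgroupH1 p κ.kerSubgroup)) '' {s | p • s = 0} := by
    rintro _ ⟨s, hs, rfl⟩
    have hs' : p • (s : W.subgroupH1 p κ.kerSubgroup) = 0 := by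
      rw [← AddSubgroupClass.coe_nsmul, show p • s = 0 from hs]; rfl
    refine ⟨⟨(s : W.subgroupH1 p κ.kerSubgroup), selmerAc_empty_le s.2⟩, ?_, rfl⟩
    show p • (⟨(s : W.subgroupH1 p κ.kerSubgroup), selmerAc_empty_le s.2⟩ : selmerAc W p κ 𝔭 S) = 0
    exact Subtype.ext (by rw [AddSubgroupClass.coe_nsmul]; exact hs')
  exact Set.Finite.of_finite_image ((hfin.image _).subset himg) Subtype.val_injective.injOn

end Summit.BirchSwinnertonDyer.BirchSwinnertonDyer.Theorems.UniversalToricDescentSigmaPassage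

end
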